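import Summits.FinalStateConjecture.FinalStateConjecture.Theorems.EIHFluxBalanceInertialRecessionStubHigherOrderSummandAt
import Summits.FinalStateConjecture.FinalStateConjecture.Theorems.EIHFluxBalanceInertialRecessionStubHigherOrderSliceSums
import Summits.FinalStateConjecture.FinalStateConjecture.Theorems.EIHFluxBalanceInertialRecessionStubHigherOrderBoxes

/-!
# Route EIHFluxBalance — `InertialRecession` (E′), line `SketchCleanExcision`, skeleton r13,
# stub `stub_higherOrderSlaving` (EF): the jets of the frozen ansatz at a slice point near a hole,
# in terms of the visible sizes of all holes

Helper file for the crux `stmt-FinalStateConjecture-17403`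
(`Summit.FinalStateConjecture.FinalStateConjecture.Theses.EIHFluxBalance.InertialRecession`, E′),
registered stub `stub_higherOrderSlaving` (orders two and three of frozen-vacuum slaving).

`higherOrder_jetBounds`: for painted moduli with representative frames `Λ̃ⱼ` and the per-hole
packages (`…StubHigherOrderHolePackage`, hypothesis `hpack`), there is `C` such that at every slice
point `x` (`x⁰ = t`) in the own box of hole `i` (`‖x − cᵢ‖ ≤ R₀`, `rᵢ ≥ r₁` in the frame `Λ̃ᵢ`),
at lab distance `≥ max(1, 2|aⱼ|)` from every other centre and with all first-order sizes `≤ 1`: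
the derivatives of the frozen field are `≤ C`, the frozen field minus the frozen own summand and
its derivatives are `≤ C Σ_{j ≠ i} ‖x − cⱼ‖⁻¹`, the first variation and its derivatives are
`≤ C Σⱼ E₁ⱼ`, the second variation is the coercivity variation form `W₂` of hole `i` up to
`C (E₁ᵢ + Σ_{j≠i} ‖x − cⱼ‖⁻¹(E₂ⱼ + 2E₁ⱼ))`, `‖P₂‖, ‖DP₂‖ ≤ C Σⱼ (E₂ⱼ + 2E₁ⱼ)`, and (all
`E₂ⱼ ≤ 1`) the third variation is `W₃` up to `C (E₁ᵢ + Σ_{j≠i} ‖x − cⱼ‖⁻¹(E₃ⱼ + E₂ⱼ + E₁ⱼ))`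
with `‖P₃‖ ≤ C Σⱼ (E₃ⱼ + E₂ⱼ + E₁ⱼ)` (`…StubHigherOrderSummandAt`, `…StubHigherOrderSliceSums`,
`…StubHigherOrderBoxes`).

No definitions, no named facts, no `sorry`.
-/

set_option linter.dupNamespace false
set_option maxSynthPendingDepth 6
set_option synthInstance.maxHeartbeats 200000

noncomputable section

namespace Summit.FinalStateConjecture.FinalStateConjecture.Theorems.SublinearIsFree.Slaving

open scoped Topology ContDiff BigOperators
open Filter Set Function Literature.Geometry.Lorentzian
  Summit.FinalStateConjecture.FinalStateConjecture.Theorems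

/-- Sums with coefficients bounded by a constant. [folklore] -/
theorem higherOrder_sum_coeff_le {N : ℕ} (s : Finset (Fin N)) {c e : Fin N → ℝ} {C : ℝ}
    (hc : ∀ j ∈ s, c j ≤ C) (he : ∀ j ∈ s, 0 ≤ e j) : ∑ j ∈ s, c j * e j ≤ C * ∑ j ∈ s, e j := by
  rw [Finset.mul_sum]
  exact Finset.sum_le_sum fun j hj ↦ mul_le_mul_of_nonneg_right (hc j hj) (he j hj)

/-- Norm of a sum through termwise bounds. [folklore] -/
theorem higherOrder_norm_sum_le_of_le {F : Type*} [SeminormedAddCommGroup F] {N : ℕ} (s : Finset (Fin N))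
    {f : Fin N → F} {b : Fin N → ℝ} (h : ∀ j ∈ s, ‖f j‖ ≤ b j) : ‖∑ j ∈ s, f j‖ ≤ ∑ j ∈ s, b j :=
  (norm_sum_le _ _).trans (Finset.sum_le_sum h)

set_option maxHeartbeats 12800000 in
/-- **The jets of the frozen ansatz at a slice point near a hole.** See the module docstring.
[folklore] -/
theorem higherOrder_jetBounds {N : ℕ} (M a : Fin N → ℝ) (Λ Λ' : Fin N → ℝ → lorentzGroup) (ξ : Fin N → ℝ → E3)
    (Q : Fin N → ℝ) {γ : ℝ}
    (hsm : ∀ j, ContDiff ℝ ∞ (ξ j) ∧ ContDiff ℝ ∞ (fun t ↦ ((Λ j t : E4 ≃L[ℝ] E4) : E4 →L[ℝ] E4)))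
    (hΛ's : ∀ j, ContDiff ℝ ∞ (fun t ↦ ((Λ' j t : E4 ≃L[ℝ] E4) : E4 →L[ℝ] E4)))
    (hγ' : ∀ j t, |((Λ' j t : E4 ≃L[ℝ] E4) (E4.basisVector 0)) 0| ≤ γ) (hQ1 : ∀ j, 1 ≤ Q j)
    (hpack : ∀ j : Fin N, ∀ t : ℝ, let F : ℝ → E4 →L[ℝ] E4 := fun s ↦ ((Λ' j s : E4 ≃L[ℝ] E4) : E4 →L[ℝ] E4); let S : ℝ → E4 →L[ℝ] E4 := fun s ↦ (((Λ' j s : E4 ≃L[ℝ] E4).symm : E4 ≃L[ℝ] E4) : E4 →L[ℝ] E4); let A : ℝ → E4 →L[ℝ] E4 := fun s ↦ (deriv S s).comp (F s); let u : ℝ → E4 := fun s ↦ (Λ j s : E4 ≃L[ℝ] E4) (E4.basisVector 0); let n : ℝ → E4 := fun s ↦ (Λ j s : E4 ≃L[ℝ] E4) (E4.basisVector 3); let μ : ℝ → E3 := fun s ↦ deriv (ξ j) s - ((u s) 0)⁻¹ • E4.spatial (u s); let cc : ℝ → E4 := fun s ↦ E4.ofTimeSpace s (ξ j s) - ((s -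 t) * (u t 0)⁻¹) • u s; let E₁ : ℝ := ‖deriv u t‖ + ‖μ t‖ + (if a j = 0 then 0 else ‖deriv n t‖); let E₂ : ℝ := ‖iteratedDeriv 2 u t‖ + ‖deriv μ t‖ + (if a j = 0 then 0 else ‖iteratedDeriv 2 n t‖); let E₃ : ℝ := ‖iteratedDeriv 3 u t‖ + ‖iteratedDeriv 2 μ t‖ + (if a j = 0 then 0 else ‖iteratedDeriv 3 n t‖); ‖F t‖ ≤ Q j ∧ ‖S t‖ ≤ Q j ∧ (ContDiff ℝ ((⊤ : ℕ∞) : WithTop ℕ∞) cc ∧ cc t = E4.ofTimeSpace t (ξ j t) ∧ deriv cc t = E4.spaceEmbed (μ t) ∧ ∀ (M s : ℝ) (z : E4), boostedKerrBilin (Λ j s) (E4.ofTimeSpace s (ξ j s)) M (a j) z = boostedKerrBilin (Λ' j s) (cc s) M (a j) z) ∧ ‖deriv S t‖ + ‖deriv cc t‖ ≤ Q j * E₁ ∧ (E₁ ≤ 1 → ‖iteratedDeriv 2 S t‖ + ‖iteratedDeriv 2 cc t‖ ≤ Q j * (E₂ + E₁)) ∧ (E₁ ≤ 1 → E₂ ≤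 1 → ‖iteratedDeriv 3 S t‖ + ‖iteratedDeriv 3 cc t‖ ≤ Q j * (E₃ + E₂ + E₁)) ∧ ‖A t‖ ≤ Q j * E₁ ∧ (E₁ ≤ 1 → ‖deriv A t‖ ≤ Q j * (E₂ + E₁)) ∧ (E₁ ≤ 1 → E₂ ≤ Q j * ((‖deriv A t (E4.basisVector 0)‖ + ‖E4.spatial (S t (-(iteratedDeriv 2 cc t)))‖ + ‖a j • deriv A t (E4.basisVector 3)‖) + E₁)) ∧ (E₁ ≤ 1 → E₂ ≤ 1 → E₃ ≤ Q j * ((‖iteratedDeriv 2 A t (E4.basisVector 0)‖ + ‖E4.spatial (S t (-(iteratedDeriv 3 cc t)))‖ + ‖a j • iteratedDeriv 2 A t (E4.basisVector 3)‖) + E₂ + E₁)))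
    (i : Fin N) (R₀ : ℝ) {r₁ : ℝ} (hr₁ : 0 < r₁) :
    ∃ C : ℝ, 0 ≤ C ∧ ∀ (t : ℝ) (x : E4), x 0 = t →
      (∀ j, 0 < Kerr.radius (a j) (poincareInv (Λ j t) (E4.ofTimeSpace t (ξ j t)) x)) →
      ‖x - E4.ofTimeSpace t (ξ i t)‖ ≤ R₀ →
      r₁ ≤ Kerr.radius (a i) (poincareInv (Λ' i t) (E4.ofTimeSpace t (ξ i t)) x) →
      (∀ j, j ≠ i → 1 ≤ ‖x - E4.ofTimeSpace t (ξ j t)‖ ∧ 2 * |a j| ≤ ‖x - E4.ofTimeSpace t (ξ j t)‖) →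
      let u : Fin N → ℝ → E4 := fun j s ↦ (Λ j s : E4 ≃L[ℝ] E4) (E4.basisVector 0)
      let n : Fin N → ℝ → E4 := fun j s ↦ (Λ j s : E4 ≃L[ℝ] E4) (E4.basisVector 3)
      let μ : Fin N → ℝ → E3 := fun j s ↦ deriv (ξ j) s - ((u j s) 0)⁻¹ • E4.spatial (u j s)
      let E₁ : Fin N → ℝ := fun j ↦ ‖deriv (u j) t‖ + ‖μ j t‖ + (if a j = 0 then 0 else ‖deriv (n j) t‖)
      let E₂ : Fin N → ℝ := fun j ↦ ‖iteratedDeriv 2 (u j) t‖ + ‖deriv (μ j) t‖ +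
        (if a j = 0 then 0 else ‖iteratedDeriv 2 (n j) t‖)
      let E₃ : Fin N → ℝ := fun j ↦ ‖iteratedDeriv 3 (u j) t‖ + ‖iteratedDeriv 2 (μ j) t‖ +
        (if a j = 0 then 0 else ‖iteratedDeriv 3 (n j) t‖)
      let Φ : ℝ × E4 → E4 →L[ℝ] E4 →L[ℝ] ℝ := fun q ↦ Minkowski.bilin + ∑ j, (boostedKerrBilin (Λ j q.1)
        (E4.ofTimeSpace q.1 (ξ j q.1)) (M j) (a j) q.2 - Minkowski.bilin)
      let G₀ : E4 → E4 →L[ℝ] E4 →L[ℝ] ℝ := fun z ↦ Φ (t, z)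
      let P₁ : E4 → E4 →L[ℝ] E4 →L[ℝ] ℝ := fun z ↦ deriv (fun s ↦ Φ (s, z)) t
      let P₂ : E4 → E4 →L[ℝ] E4 →L[ℝ] ℝ := fun z ↦ iteratedDeriv 2 (fun s ↦ Φ (s, z)) t
      let P₃ : E4 → E4 →L[ℝ] E4 →L[ℝ] ℝ := fun z ↦ iteratedDeriv 3 (fun s ↦ Φ (s, z)) t
      let K : E4 → E4 →L[ℝ] E4 →L[ℝ] ℝ := fun z ↦ boostedKerrBilin (Λ' i t) (E4.ofTimeSpace t (ξ i t)) (M i) (a i) z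
      let Fi : ℝ → E4 →L[ℝ] E4 := fun s ↦ ((Λ' i s : E4 ≃L[ℝ] E4) : E4 →L[ℝ] E4)
      let Si : ℝ → E4 →L[ℝ] E4 := fun s ↦ (((Λ' i s : E4 ≃L[ℝ] E4).symm : E4 ≃L[ℝ] E4) : E4 →L[ℝ] E4)
      let Ai : ℝ → E4 →L[ℝ] E4 := fun s ↦ (deriv Si s).comp (Fi s)
      let cci : ℝ → E4 := fun s ↦ E4.ofTimeSpace s (ξ i s) - ((s - t) * (u i t 0)⁻¹) • u i s
      (∀ j, E₁ j ≤ 1) →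
      (‖fderiv ℝ G₀ x‖ ≤ C ∧ ‖fderiv ℝ (fderiv ℝ G₀) x‖ ≤ C ∧ ‖fderiv ℝ (fderiv ℝ (fderiv ℝ G₀)) x‖ ≤ C) ∧
      (‖G₀ x - K x‖ ≤ C * ∑ j ∈ Finset.univ.erase i, ‖x - E4.ofTimeSpace t (ξ j t)‖⁻¹ ∧
        ‖fderiv ℝ G₀ x - fderiv ℝ K x‖ ≤ C * ∑ j ∈ Finset.univ.erase i, ‖x - E4.ofTimeSpace t (ξ j t)‖⁻¹ ∧
        ‖fderiv ℝ (fderiv ℝ G₀) x - fderiv ℝ (fderiv ℝ K) x‖ ≤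
          C * ∑ j ∈ Finset.univ.erase i, ‖x - E4.ofTimeSpace t (ξ j t)‖⁻¹ ∧
        ‖fderiv ℝ (fderiv ℝ (fderiv ℝ G₀)) x - fderiv ℝ (fderiv ℝ (fderiv ℝ K)) x‖ ≤
          C * ∑ j ∈ Finset.univ.erase i, ‖x - E4.ofTimeSpace t (ξ j t)‖⁻¹) ∧
      (‖P₁ x‖ ≤ C * ∑ j, E₁ j ∧ ‖fderiv ℝ P₁ x‖ ≤ C * ∑ j, E₁ j ∧ ‖fderiv ℝ (fderiv ℝ P₁) x‖ ≤ C * ∑ j, E₁ j) ∧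
      (‖P₂ x - ((fderiv ℝ (Kerr.bilin (M i) (a i)) (poincareInv (Λ' i t) 0 (x - E4.ofTimeSpace t (ξ i t))) (deriv Ai t (poincareInv (Λ' i t) 0 (x - E4.ofTimeSpace t (ξ i t))) + Si t (-(iteratedDeriv 2 cci t)))).bilinearComp ((((Λ' i t) : E4 ≃L[ℝ] E4).symm : E4 →L[ℝ] E4)) ((((Λ' i t) : E4 ≃L[ℝ] E4).symm : E4 →L[ℝ] E4)) + (Kerr.bilin (M i) (a i) (poincareInv (Λ' i t) 0 (x - E4.ofTimeSpace t (ξ i t)))).bilinearComp ((deriv Ai t).comp ((((Λ' i t) : E4 ≃L[ℝ] E4).symm : E4 →L[ℝ] E4))) ((((Λ' i t) : E4 ≃L[ℝ] E4).symm : E4 →L[ℝ] E4)) + (Kerr.bilin (M i) (a i) (poincareInv (Λ' i t) 0 (x - E4.ofTimeSpace t (ξ i t)))).bilinearComp ((((Λ' i t) : E4 ≃L[ℝ] E4).symm : E4 →L[ℝ] E4)) ((deriv Ai t).comp ((((Λ' i t) : E4 ≃L[ℝ] E4).symm : E4 →L[ℝ] E4))))‖ ≤ C * (E₁ i + ∑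 j ∈ Finset.univ.erase i, ‖x - E4.ofTimeSpace t (ξ j t)‖⁻¹ * (E₂ j + 2 * E₁ j)) ∧
        ‖P₂ x‖ ≤ C * ∑ j, (E₂ j + 2 * E₁ j) ∧ ‖fderiv ℝ P₂ x‖ ≤ C * ∑ j, (E₂ j + 2 * E₁ j)) ∧
      ((∀ j, E₂ j ≤ 1) →
        ‖P₃ x - ((fderiv ℝ (Kerr.bilin (M i) (a i)) (poincareInv (Λ' i t) 0 (x - E4.ofTimeSpace t (ξ i t))) (iteratedDeriv 2 Ai t (poincareInv (Λ' i t) 0 (x - E4.ofTimeSpace t (ξ i t))) + Si t (-(iteratedDeriv 3 cci t)))).bilinearComp ((((Λ' i t) : E4 ≃L[ℝ] E4).symm : E4 →L[ℝ] E4)) ((((Λ' i t) : E4 ≃L[ℝ] E4).symm : E4 →L[ℝ] E4)) + (Kerr.bilin (M i) (a i) (poincareInv (Λ' i t) 0 (x - E4.ofTimeSpace t (ξ i t)))).bilinearComp ((iteratedDeriv 2 Ai t).comp ((((Λ' i t) : E4 ≃L[ℝ] E4).symm : E4 →L[ℝ] E4))) ((((Λ' i t) : E4 ≃L[ℝ]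 E4).symm : E4 →L[ℝ] E4)) + (Kerr.bilin (M i) (a i) (poincareInv (Λ' i t) 0 (x - E4.ofTimeSpace t (ξ i t)))).bilinearComp ((((Λ' i t) : E4 ≃L[ℝ] E4).symm : E4 →L[ℝ] E4)) ((iteratedDeriv 2 Ai t).comp ((((Λ' i t) : E4 ≃L[ℝ] E4).symm : E4 →L[ℝ] E4))))‖ ≤ C * (E₁ i + ∑ j ∈ Finset.univ.erase i, ‖x - E4.ofTimeSpace t (ξ j t)‖⁻¹ * (E₃ j + E₂ j + E₁ j)) ∧
        ‖P₃ x‖ ≤ C * ∑ j, (E₃ j + E₂ j + E₁ j)) := by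
  -- the common parameter box and the two constants
  have hr₁' : 0 < min r₁ (1 / 2) := lt_min hr₁ (by norm_num)
  obtain ⟨C₁, hC₁0, hsum⟩ := higherOrder_summandAt (∑ k, |a k|) γ (max R₀ 1) hr₁'
  obtain ⟨C₂, hC₂0, hown⟩ := higherOrder_summandAt_own (∑ k, |a k|) γ (max R₀ 1) hr₁'
  set C : ℝ := ∑ j, |M j| * (C₁ + C₂) * Q j ^ 4 * 14 + 1 with hCdef
  have hQ0 : ∀ j, 0 ≤ Q j := fun j ↦ zero_le_one.trans (hQ1 j)
  have hterm0 : ∀ j, 0 ≤ |M j| * (C₁ + C₂) * Q j ^ 4 * 14 := fun j ↦ by positivity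
  have hC0 : 0 ≤ C := by positivity
  have hCj : ∀ j, |M j| * (C₁ + C₂) * Q j ^ 4 * 14 ≤ C := fun j ↦ by
    rw [hCdef]
    have h := Finset.single_le_sum (f := fun j ↦ |M j| * (C₁ + C₂) * Q j ^ 4 * 14) (fun j _ ↦ hterm0 j)
      (Finset.mem_univ j)
    linarith
  have hCsum : ∑ j, |M j| * (C₁ + C₂) * Q j ^ 4 * 14 ≤ C := by rw [hCdef]; linarith
  refine ⟨C, hC0, fun t x hx0 hrad hR₀ hr hfar ↦ ?_⟩
  intro u n μ E₁ E₂ E₃ Φ G₀ P₁ P₂ P₃ K Fi Si Ai cci hE₁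
  have hE₁0 : ∀ j, 0 ≤ E₁ j := fun j ↦ by positivity
  have hE₂0 : ∀ j, 0 ≤ E₂ j := fun j ↦ by positivity
  have hE₃0 : ∀ j, 0 ≤ E₃ j := fun j ↦ by positivity
  -- scales
  set ρ : Fin N → ℝ := fun j ↦ if j = i then 1 else ‖x - E4.ofTimeSpace t (ξ j t)‖ with hρdef
  have hρ1 : ∀ j, 1 ≤ ρ j := fun j ↦ by
    by_cases hj : j = i
    · simp [hρdef, hj]
    · simp only [hρdef, if_neg hj]; exact (hfar j hj).1
  have hρ0 : ∀ j, 0 < ρ j := fun j ↦ one_pos.trans_le (hρ1 j)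
  -- box membership of every hole
  have hai : ∀ j, |a j| ≤ ∑ k, |a k| := fun j ↦
    Finset.single_le_sum (f := fun k ↦ |a k|) (fun k _ ↦ abs_nonneg (a k)) (Finset.mem_univ j)
  have hbox : ∀ j, (((ρ j)⁻¹ * a j, (((Λ' j t : E4 ≃L[ℝ] E4).symm : E4 ≃L[ℝ] E4) : E4 →L[ℝ] E4),
      (ρ j)⁻¹ • (x - E4.ofTimeSpace t (ξ j t))) : ℝ × (E4 →L[ℝ] E4) × E4) ∈ {p : ℝ × (E4 →L[ℝ] E4) × E4 | |p.1| ≤ (∑ k, |a k|) ∧ ((∀ v w, Minkowski.bilin (p.2.1 v) (p.2.1 w) = Minkowski.bilin v w) ∧ |p.2.1 (E4.basisVector 0) 0| ≤ γ) ∧ ‖p.2.2‖ ≤ max R₀ 1 ∧ min r₁ (1 / 2) ≤ Kerr.radius p.1 (p.2.1 p.2.2)} := by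
    intro j
    obtain ⟨hL1, hL2⟩ := higherOrder_inverse_lorentzBox (Λ' j t) (hγ' j t)
    refine ⟨?_, ⟨hL1, hL2⟩, ?_, ?_⟩
    · show |(ρ j)⁻¹ * a j| ≤ ∑ k, |a k|
      rw [abs_mul, abs_inv, abs_of_pos (hρ0 j)]
      exact (mul_le_of_le_one_left (abs_nonneg _) (inv_le_one_of_one_le₀ (hρ1 j))).trans (hai j)
    · show ‖(ρ j)⁻¹ • (x - E4.ofTimeSpace t (ξ j t))‖ ≤ max R₀ 1
      by_cases hj : j = i
      · subst hj
        simp only [hρdef, if_pos rfl, inv_one, one_smul]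
        exact hR₀.trans (le_max_left _ _)
      · simp only [hρdef, if_neg hj]
        have hx0' : x 0 = (E4.ofTimeSpace t (ξ j t)) 0 := by rw [E4.ofTimeSpace_apply_zero, hx0]
        exact (higherOrder_far_box (Λ' j t) _ x (a j) hx0' (hfar j hj).1 (hfar j hj).2).1.trans (le_max_right _ _)
    · show min r₁ (1 / 2) ≤ Kerr.radius ((ρ j)⁻¹ * a j)
        ((((Λ' j t : E4 ≃L[ℝ] E4).symm : E4 ≃L[ℝ] E4) : E4 →L[ℝ] E4) ((ρ j)⁻¹ • (x - E4.ofTimeSpace t (ξ j t))))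
      by_cases hj : j = i
      · subst hj
        simp only [hρdef, if_pos rfl, inv_one, one_smul, one_mul]
        exact (min_le_left _ _).trans hr
      · simp only [hρdef, if_neg hj]
        have hx0' : x 0 = (E4.ofTimeSpace t (ξ j t)) 0 := by rw [E4.ofTimeSpace_apply_zero, hx0]
        exact (min_le_right _ _).trans (higherOrder_far_box (Λ' j t) _ x (a j) hx0' (hfar j hj).1 (hfar j hj).2).2
  -- the per-summand bounds
  have hS : ∀ j, _ := fun j ↦ hsum (Λ j) (Λ' j) (ξ j) (M j) (a j) (Q j) t x (ρ j) (hΛ's j) (hpack j)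
    (hQ1 j) (hρ1 j) hx0 (hbox j) (hE₁ j)
  -- coefficients
  have hcoef : ∀ j, |M j| / ρ j * C₁ * Q j ^ 4 ≤ (ρ j)⁻¹ * (|M j| * (C₁ + C₂) * Q j ^ 4 * 14) := fun j ↦ by
    rw [div_eq_mul_inv]
    have h1 : C₁ ≤ (C₁ + C₂) * 14 := by nlinarith
    have h2 : 0 ≤ |M j| * (ρ j)⁻¹ * Q j ^ 4 := by positivity
    nlinarith [mul_le_mul_of_nonneg_left h1 h2]
  have hcoef1 : ∀ j, |M j| / ρ j * C₁ * Q j ^ 4 ≤ C := fun j ↦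
    (hcoef j).trans ((mul_le_of_le_one_left (hterm0 j) (inv_le_one_of_one_le₀ (hρ1 j))).trans (hCj j))
  have hcoefρ : ∀ j, |M j| / ρ j * C₁ * Q j ^ 4 ≤ C * (ρ j)⁻¹ := fun j ↦
    (hcoef j).trans (by rw [mul_comm]; exact mul_le_mul_of_nonneg_right (hCj j) (inv_nonneg.2 (hρ0 j).le))
  -- the own box at scale one
  have hboxi : ((a i, (((Λ' i t : E4 ≃L[ℝ] E4).symm : E4 ≃L[ℝ] E4) : E4 →L[ℝ] E4),
      x - E4.ofTimeSpace t (ξ i t)) : ℝ × (E4 →L[ℝ] E4) × E4) ∈ {p : ℝ × (E4 →L[ℝ] E4) × E4 | |p.1| ≤ (∑ k, |a k|) ∧ ((∀ v w, Minkowski.bilin (p.2.1 v) (p.2.1 w) = Minkowski.bilin v w) ∧ |p.2.1 (E4.basisVector 0) 0| ≤ γ) ∧ ‖p.2.2‖ ≤ max R₀ 1 ∧ min r₁ (1 / 2) ≤ Kerr.radius p.1 (p.2.1 p.2.2)} := by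
    obtain ⟨hL1, hL2⟩ := higherOrder_inverse_lorentzBox (Λ' i t) (hγ' i t)
    exact ⟨hai i, ⟨hL1, hL2⟩, hR₀.trans (le_max_left _ _), (min_le_left _ _).trans hr⟩
  have hO := hown (Λ i) (Λ' i) (ξ i) (M i) (a i) (Q i) t x (hΛ's i) (hpack i) (hQ1 i) hx0 hboxi (hE₁ i)
  -- the painting identity of the own representative frame at `t`
  obtain ⟨-, -, ⟨-, hccti, -, hcpi⟩, -⟩ := hpack i t
  have hL : ∀ z, boostedKerrBilin (Λ' i t) (E4.ofTimeSpace t (ξ i t)) (M i) (a i) z =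
      boostedKerrBilin (Λ i t) (E4.ofTimeSpace t (ξ i t)) (M i) (a i) z := fun z ↦ by
    have h := hcpi (M i) t z
    have hc : cci t = E4.ofTimeSpace t (ξ i t) := hccti
    have h' : boostedKerrBilin (Λ i t) (E4.ofTimeSpace t (ξ i t)) (M i) (a i) z =
        boostedKerrBilin (Λ' i t) (cci t) (M i) (a i) z := h
    rw [hc] at h'; exact h'.symm
  -- the sums
  obtain ⟨hGK0, ⟨hGK1, hGK2, hGK3⟩, ⟨hG1, hG2, hG3⟩, ⟨hP1, hP1', hP1''⟩, ⟨hP2, hP2'⟩, hP3⟩ :=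
    higherOrder_sliceSums N M a Λ ξ (fun j ↦ (hsm j).2) (fun j ↦ (hsm j).1) i (Λ' i t) hx0 hL hrad
  -- bookkeeping of the per-summand bounds, in the notation of the statement
  have bF : ∀ j, ‖boostedKerrBilin (Λ j t) (E4.ofTimeSpace t (ξ j t)) (M j) (a j) x - Minkowski.bilin‖ ≤ C * (ρ j)⁻¹ ∧
      ‖fderiv ℝ (fun z ↦ boostedKerrBilin (Λ j t) (E4.ofTimeSpace t (ξ j t)) (M j) (a j) z - Minkowski.bilin) x‖ ≤ C * (ρ j)⁻¹ ∧
      ‖fderiv ℝ (fderiv ℝ (fun z ↦ boostedKerrBilin (Λ j t) (E4.ofTimeSpace t (ξ j t)) (M j) (a j) z - Minkowski.bilin)) x‖ ≤ C * (ρ j)⁻¹ ∧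
      ‖fderiv ℝ (fderiv ℝ (fderiv ℝ (fun z ↦ boostedKerrBilin (Λ j t) (E4.ofTimeSpace t (ξ j t)) (M j) (a j) z - Minkowski.bilin))) x‖ ≤ C * (ρ j)⁻¹ := by
    intro j
    obtain ⟨⟨h0, h1, h2, h3⟩, -⟩ := hS j
    exact ⟨h0.trans (hcoefρ j), h1.trans (hcoefρ j), h2.trans (hcoefρ j), h3.trans (hcoefρ j)⟩
  have bP₁ : ∀ j, ‖deriv (fun s ↦ boostedKerrBilin (Λ j s) (E4.ofTimeSpace s (ξ j s)) (M j) (a j) x) t‖ ≤ C * E₁ j ∧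
      ‖fderiv ℝ (fun z ↦ deriv (fun s ↦ boostedKerrBilin (Λ j s) (E4.ofTimeSpace s (ξ j s)) (M j) (a j) z) t) x‖ ≤ C * E₁ j ∧
      ‖fderiv ℝ (fderiv ℝ (fun z ↦ deriv (fun s ↦ boostedKerrBilin (Λ j s) (E4.ofTimeSpace s (ξ j s)) (M j) (a j) z) t)) x‖ ≤ C * E₁ j := by
    intro j
    obtain ⟨-, ⟨h1, h2, h3⟩, -⟩ := hS j
    have hc := mul_le_mul_of_nonneg_right (hcoef1 j) (hE₁0 j)
    exact ⟨h1.trans hc, h2.trans hc, h3.trans hc⟩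
  have bP₂ : ∀ j, ‖iteratedDeriv 2 (fun s ↦ boostedKerrBilin (Λ j s) (E4.ofTimeSpace s (ξ j s)) (M j) (a j) x) t‖ ≤
        C * (ρ j)⁻¹ * (E₂ j + 2 * E₁ j) ∧
      ‖fderiv ℝ (fun z ↦ iteratedDeriv 2 (fun s ↦ boostedKerrBilin (Λ j s) (E4.ofTimeSpace s (ξ j s)) (M j) (a j) z) t) x‖ ≤
        C * (ρ j)⁻¹ * (E₂ j + 2 * E₁ j) := by
    intro j
    obtain ⟨-, -, ⟨h1, h2⟩, -⟩ := hS j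
    have hc := mul_le_mul_of_nonneg_right (hcoefρ j) (by positivity : 0 ≤ E₂ j + 2 * E₁ j)
    exact ⟨h1.trans hc, h2.trans hc⟩
  have bP₃ : (∀ j, E₂ j ≤ 1) → ∀ j, ‖iteratedDeriv 3 (fun s ↦ boostedKerrBilin (Λ j s) (E4.ofTimeSpace s (ξ j s)) (M j) (a j) x) t‖ ≤
      C * (ρ j)⁻¹ * (E₃ j + E₂ j + E₁ j) := by
    intro hE₂ j
    obtain ⟨-, -, -, h3⟩ := hS j
    have h := h3 (hE₂ j)
    refine h.trans ?_
    have k : |M j| / ρ j * C₁ * Q j ^ 4 * (5 * (E₃ j + E₂ j + E₁ j)) =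
        (|M j| / ρ j * C₁ * Q j ^ 4 * 5) * (E₃ j + E₂ j + E₁ j) := by ring
    rw [k]
    refine mul_le_mul_of_nonneg_right ?_ (by positivity)
    -- `5 |M| C₁ Q⁴ / ρ ≤ C / ρ`
    have h5 : |M j| / ρ j * C₁ * Q j ^ 4 * 5 ≤ (ρ j)⁻¹ * (|M j| * (C₁ + C₂) * Q j ^ 4 * 14) := by
      rw [div_eq_mul_inv]
      have h1 : C₁ * 5 ≤ (C₁ + C₂) * 14 := by nlinarith
      have h2 : 0 ≤ |M j| * (ρ j)⁻¹ * Q j ^ 4 := by positivity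
      nlinarith [mul_le_mul_of_nonneg_left h1 h2]
    exact h5.trans (by rw [mul_comm]; exact mul_le_mul_of_nonneg_right (hCj j) (inv_nonneg.2 (hρ0 j).le))
  -- `ρ i = 1`, `ρ j = ‖x − cⱼ‖` for `j ≠ i`
  have hρi : ρ i = 1 := by simp [hρdef]
  have hρj : ∀ j ∈ Finset.univ.erase i, (ρ j)⁻¹ = ‖x - E4.ofTimeSpace t (ξ j t)‖⁻¹ := fun j hj ↦ by
    rw [Finset.mem_erase] at hj
    simp only [hρdef, if_neg hj.1]
  have hρle1 : ∀ j, (ρ j)⁻¹ ≤ 1 := fun j ↦ inv_le_one_of_one_le₀ (hρ1 j)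
  -- the own model terms
  obtain ⟨hO2, hO3⟩ := hO
  have hO2' : ‖iteratedDeriv 2 (fun s ↦ boostedKerrBilin (Λ i s) (E4.ofTimeSpace s (ξ i s)) (M i) (a i) x) t - ((fderiv ℝ (Kerr.bilin (M i) (a i)) (poincareInv (Λ' i t) 0 (x - E4.ofTimeSpace t (ξ i t))) (deriv Ai t (poincareInv (Λ' i t) 0 (x - E4.ofTimeSpace t (ξ i t))) + Si t (-(iteratedDeriv 2 cci t)))).bilinearComp ((((Λ' i t) : E4 ≃L[ℝ] E4).symm : E4 →L[ℝ] E4)) ((((Λ' i t) : E4 ≃L[ℝ] E4).symm : E4 →L[ℝ] E4)) + (Kerr.bilin (M i) (a i) (poincareInv (Λ' i t) 0 (x - E4.ofTimeSpace t (ξ i t)))).bilinearComp ((deriv Ai t).comp ((((Λ' i t) : E4 ≃L[ℝ] E4).symm : E4 →L[ℝ] E4))) ((((Λ' i t) : E4 ≃L[ℝ] E4).symm : E4 →L[ℝ] E4)) + (Kerr.bilin (M i) (a i) (poincareInv (Λ' i t) 0 (x - E4.ofTimeSpace t (ξ i t)))).bilinearComp ((((Λ' i t) : E4 ≃L[ℝ]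 E4).symm : E4 →L[ℝ] E4)) ((deriv Ai t).comp ((((Λ' i t) : E4 ≃L[ℝ] E4).symm : E4 →L[ℝ] E4))))‖ ≤
      |M i| * C₂ * Q i ^ 4 * (2 * E₁ i) := hO2
  have hMC₂ : |M i| * C₂ * Q i ^ 4 * 2 ≤ C := by
    have h1 : C₂ * 2 ≤ (C₁ + C₂) * 14 := by nlinarith
    have h2 : 0 ≤ |M i| * Q i ^ 4 := by positivity
    nlinarith [mul_le_mul_of_nonneg_left h1 h2, hCj i]
  have hMC₂' : |M i| * C₂ * Q i ^ 4 * 14 ≤ C := by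
    have h1 : C₂ * 14 ≤ (C₁ + C₂) * 14 := by nlinarith
    have h2 : 0 ≤ |M i| * Q i ^ 4 := by positivity
    nlinarith [mul_le_mul_of_nonneg_left h1 h2, hCj i]
  have hO3' : E₂ i ≤ 1 → ‖iteratedDeriv 3 (fun s ↦ boostedKerrBilin (Λ i s) (E4.ofTimeSpace s (ξ i s)) (M i) (a i) x) t - ((fderiv ℝ (Kerr.bilin (M i) (a i)) (poincareInv (Λ' i t) 0 (x - E4.ofTimeSpace t (ξ i t))) (iteratedDeriv 2 Ai t (poincareInv (Λ' i t) 0 (x - E4.ofTimeSpace t (ξ i t))) + Si t (-(iteratedDeriv 3 cci t)))).bilinearComp ((((Λ' i t) : E4 ≃L[ℝ] E4).symm : E4 →L[ℝ] E4)) ((((Λ' i t) : E4 ≃L[ℝ] E4).symm : E4 →L[ℝ] E4)) + (Kerr.bilin (M i) (a i) (poincareInv (Λ' i t) 0 (x - E4.ofTimeSpace t (ξ i t)))).bilinearComp ((iteratedDeriv 2 Ai t).comp ((((Λ' i t) : E4 ≃L[ℝ] E4).symm : E4 →L[ℝ] E4))) ((((Λ' i t) : E4 ≃L[ℝ] E4).symm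 : E4 →L[ℝ] E4)) + (Kerr.bilin (M i) (a i) (poincareInv (Λ' i t) 0 (x - E4.ofTimeSpace t (ξ i t)))).bilinearComp ((((Λ' i t) : E4 ≃L[ℝ] E4).symm : E4 →L[ℝ] E4)) ((iteratedDeriv 2 Ai t).comp ((((Λ' i t) : E4 ≃L[ℝ] E4).symm : E4 →L[ℝ] E4))))‖ ≤
      |M i| * C₂ * Q i ^ 4 * (14 * E₁ i) := hO3
  -- sums of coefficients
  have hsumC : ∀ (e : Fin N → ℝ), (∀ j, 0 ≤ e j) → ∑ j, C * (ρ j)⁻¹ * e j ≤ C * ∑ j, e j := fun e he ↦ by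
    rw [Finset.mul_sum]
    exact Finset.sum_le_sum fun j _ ↦ by
      rw [mul_assoc]
      exact mul_le_mul_of_nonneg_left (mul_le_of_le_one_left (he j) (hρle1 j)) hC0
  have hsumE : ∑ j ∈ Finset.univ.erase i, C * (ρ j)⁻¹ = C * ∑ j ∈ Finset.univ.erase i, ‖x - E4.ofTimeSpace t (ξ j t)‖⁻¹ := by
    rw [Finset.mul_sum]; exact Finset.sum_congr rfl fun j hj ↦ by rw [hρj j hj]
  have hsumE' : ∀ (e : Fin N → ℝ), ∑ j ∈ Finset.univ.erase i, C * (ρ j)⁻¹ * e j =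
      C * ∑ j ∈ Finset.univ.erase i, ‖x - E4.ofTimeSpace t (ξ j t)‖⁻¹ * e j := fun e ↦ by
    rw [Finset.mul_sum]; exact Finset.sum_congr rfl fun j hj ↦ by rw [hρj j hj, mul_assoc]
  refine ⟨⟨?_, ?_, ?_⟩, ⟨?_, ?_, ?_, ?_⟩, ⟨?_, ?_, ?_⟩, ⟨?_, ?_, ?_⟩, fun hE₂ ↦ ⟨?_, ?_⟩⟩
  -- frozen field
  · rw [hG1]
    exact (higherOrder_norm_sum_le_of_le _ fun j _ ↦ ((hS j).1.2.1.trans (hcoef j))).trans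
      ((Finset.sum_le_sum fun j _ ↦ mul_le_of_le_one_left (hterm0 j) (hρle1 j)).trans hCsum)
  · rw [hG2]
    exact (higherOrder_norm_sum_le_of_le _ fun j _ ↦ ((hS j).1.2.2.1.trans (hcoef j))).trans
      ((Finset.sum_le_sum fun j _ ↦ mul_le_of_le_one_left (hterm0 j) (hρle1 j)).trans hCsum)
  · rw [hG3]
    exact (higherOrder_norm_sum_le_of_le _ fun j _ ↦ ((hS j).1.2.2.2.trans (hcoef j))).trans
      ((Finset.sum_le_sum fun j _ ↦ mul_le_of_le_one_left (hterm0 j) (hρle1 j)).trans hCsum)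
  -- frozen field minus the own frozen summand
  · rw [hGK0 x, ← hsumE]
    exact higherOrder_norm_sum_le_of_le _ fun j _ ↦ (bF j).1
  · rw [hGK1, ← hsumE]
    exact higherOrder_norm_sum_le_of_le _ fun j _ ↦ (bF j).2.1
  · rw [hGK2, ← hsumE]
    exact higherOrder_norm_sum_le_of_le _ fun j _ ↦ (bF j).2.2.1
  · rw [hGK3, ← hsumE]
    exact higherOrder_norm_sum_le_of_le _ fun j _ ↦ (bF j).2.2.2
  -- first variation
  · have h : P₁ x = ∑ j, deriv (fun s ↦ boostedKerrBilin (Λ j s) (E4.ofTimeSpace s (ξ j s)) (M j) (a j) x) t := hP1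
    rw [h, Finset.mul_sum]
    exact higherOrder_norm_sum_le_of_le _ fun j _ ↦ (bP₁ j).1
  · rw [hP1', Finset.mul_sum]
    exact higherOrder_norm_sum_le_of_le _ fun j _ ↦ (bP₁ j).2.1
  · rw [hP1'', Finset.mul_sum]
    exact higherOrder_norm_sum_le_of_le _ fun j _ ↦ (bP₁ j).2.2
  -- second variation against the own model
  · have h : P₂ x = ∑ j, iteratedDeriv 2 (fun s ↦ boostedKerrBilin (Λ j s) (E4.ofTimeSpace s (ξ j s)) (M j) (a j) x) t := hP2
    rw [h, ← Finset.add_sum_erase _ _ (Finset.mem_univ i), mul_add, ← hsumE']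
    calc _ = ‖(iteratedDeriv 2 (fun s ↦ boostedKerrBilin (Λ i s) (E4.ofTimeSpace s (ξ i s)) (M i) (a i) x) t - ((fderiv ℝ (Kerr.bilin (M i) (a i)) (poincareInv (Λ' i t) 0 (x - E4.ofTimeSpace t (ξ i t))) (deriv Ai t (poincareInv (Λ' i t) 0 (x - E4.ofTimeSpace t (ξ i t))) + Si t (-(iteratedDeriv 2 cci t)))).bilinearComp ((((Λ' i t) : E4 ≃L[ℝ] E4).symm : E4 →L[ℝ] E4)) ((((Λ' i t) : E4 ≃L[ℝ] E4).symm : E4 →L[ℝ] E4)) + (Kerr.bilin (M i) (a i) (poincareInv (Λ' i t) 0 (x - E4.ofTimeSpace t (ξ i t)))).bilinearComp ((deriv Ai t).comp ((((Λ' i t) : E4 ≃L[ℝ] E4).symm : E4 →L[ℝ] E4))) ((((Λ' i t) : E4 ≃L[ℝ] E4).symm : E4 →L[ℝ] E4)) + (Kerr.bilin (M i) (a i) (poincareInv (Λ' i t) 0 (x - E4.ofTimeSpace t (ξ i t)))).bilinearComp ((((Λ' i t) : E4 ≃L[ℝ] E4).symm : E4 →L[ℝ] E4)) ((deriv Ai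 t).comp ((((Λ' i t) : E4 ≃L[ℝ] E4).symm : E4 →L[ℝ] E4))))) +
          ∑ j ∈ Finset.univ.erase i, iteratedDeriv 2 (fun s ↦ boostedKerrBilin (Λ j s) (E4.ofTimeSpace s (ξ j s)) (M j) (a j) x) t‖ := by
          congr 1; abel
      _ ≤ ‖iteratedDeriv 2 (fun s ↦ boostedKerrBilin (Λ i s) (E4.ofTimeSpace s (ξ i s)) (M i) (a i) x) t - ((fderiv ℝ (Kerr.bilin (M i) (a i)) (poincareInv (Λ' i t) 0 (x - E4.ofTimeSpace t (ξ i t))) (deriv Ai t (poincareInv (Λ' i t) 0 (x - E4.ofTimeSpace t (ξ i t))) + Si t (-(iteratedDeriv 2 cci t)))).bilinearComp ((((Λ' i t) : E4 ≃L[ℝ] E4).symm : E4 →L[ℝ] E4)) ((((Λ' i t) : E4 ≃L[ℝ] E4).symm : E4 →L[ℝ] E4)) + (Kerr.bilin (M i) (a i) (poincareInv (Λ' i t) 0 (x - E4.ofTimeSpace t (ξ i t)))).bilinearComp ((deriv Ai t).comp ((((Λ' i t) : E4 ≃L[ℝ] E4).symm : E4 →L[ℝ] E4))) ((((Λ' i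 t) : E4 ≃L[ℝ] E4).symm : E4 →L[ℝ] E4)) + (Kerr.bilin (M i) (a i) (poincareInv (Λ' i t) 0 (x - E4.ofTimeSpace t (ξ i t)))).bilinearComp ((((Λ' i t) : E4 ≃L[ℝ] E4).symm : E4 →L[ℝ] E4)) ((deriv Ai t).comp ((((Λ' i t) : E4 ≃L[ℝ] E4).symm : E4 →L[ℝ] E4))))‖ +
          ‖∑ j ∈ Finset.univ.erase i, iteratedDeriv 2 (fun s ↦ boostedKerrBilin (Λ j s) (E4.ofTimeSpace s (ξ j s)) (M j) (a j) x) t‖ :=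
          norm_add_le _ _
      _ ≤ C * E₁ i + ∑ j ∈ Finset.univ.erase i, C * (ρ j)⁻¹ * (E₂ j + 2 * E₁ j) := by
          refine add_le_add (hO2'.trans ?_) (higherOrder_norm_sum_le_of_le _ fun j _ ↦ (bP₂ j).1)
          calc |M i| * C₂ * Q i ^ 4 * (2 * E₁ i) = (|M i| * C₂ * Q i ^ 4 * 2) * E₁ i := by ring
            _ ≤ C * E₁ i := mul_le_mul_of_nonneg_right hMC₂ (hE₁0 i)
  · have h : P₂ x = ∑ j, iteratedDeriv 2 (fun s ↦ boostedKerrBilin (Λ j s) (E4.ofTimeSpace s (ξ j s)) (M j) (a j) x) t := hP2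
    rw [h]
    exact (higherOrder_norm_sum_le_of_le _ fun j _ ↦ (bP₂ j).1).trans (hsumC _ fun j ↦ by positivity)
  · rw [hP2']
    exact (higherOrder_norm_sum_le_of_le _ fun j _ ↦ (bP₂ j).2).trans (hsumC _ fun j ↦ by positivity)
  -- third variation against the own model
  · have h : P₃ x = ∑ j, iteratedDeriv 3 (fun s ↦ boostedKerrBilin (Λ j s) (E4.ofTimeSpace s (ξ j s)) (M j) (a j) x) t := hP3
    rw [h, ← Finset.add_sum_erase _ _ (Finset.mem_univ i), mul_add, ← hsumE']
    calc _ = ‖(iteratedDeriv 3 (fun s ↦ boostedKerrBilin (Λ i s) (E4.ofTimeSpace s (ξ i s)) (M i) (a i) x) t - ((fderiv ℝ (Kerr.bilin (M i) (a i)) (poincareInv (Λ' i t) 0 (x - E4.ofTimeSpace t (ξ i t))) (iteratedDeriv 2 Ai t (poincareInv (Λ' i t) 0 (x - E4.ofTimeSpace t (ξ i t))) + Si t (-(iteratedDeriv 3 cci t)))).bilinearComp ((((Λ' i t) : E4 ≃L[ℝ] E4).symm : E4 →L[ℝ] E4)) ((((Λ' i t) : E4 ≃L[ℝ] E4).symm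 : E4 →L[ℝ] E4)) + (Kerr.bilin (M i) (a i) (poincareInv (Λ' i t) 0 (x - E4.ofTimeSpace t (ξ i t)))).bilinearComp ((iteratedDeriv 2 Ai t).comp ((((Λ' i t) : E4 ≃L[ℝ] E4).symm : E4 →L[ℝ] E4))) ((((Λ' i t) : E4 ≃L[ℝ] E4).symm : E4 →L[ℝ] E4)) + (Kerr.bilin (M i) (a i) (poincareInv (Λ' i t) 0 (x - E4.ofTimeSpace t (ξ i t)))).bilinearComp ((((Λ' i t) : E4 ≃L[ℝ] E4).symm : E4 →L[ℝ] E4)) ((iteratedDeriv 2 Ai t).comp ((((Λ' i t) : E4 ≃L[ℝ] E4).symm : E4 →L[ℝ] E4))))) +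
          ∑ j ∈ Finset.univ.erase i, iteratedDeriv 3 (fun s ↦ boostedKerrBilin (Λ j s) (E4.ofTimeSpace s (ξ j s)) (M j) (a j) x) t‖ := by
          congr 1; abel
      _ ≤ ‖iteratedDeriv 3 (fun s ↦ boostedKerrBilin (Λ i s) (E4.ofTimeSpace s (ξ i s)) (M i) (a i) x) t - ((fderiv ℝ (Kerr.bilin (M i) (a i)) (poincareInv (Λ' i t) 0 (x - E4.ofTimeSpace t (ξ i t))) (iteratedDeriv 2 Ai t (poincareInv (Λ' i t) 0 (x - E4.ofTimeSpace t (ξ i t))) + Si t (-(iteratedDeriv 3 cci t)))).bilinearComp ((((Λ' i t) : E4 ≃L[ℝ] E4).symm : E4 →L[ℝ] E4)) ((((Λ' i t) : E4 ≃L[ℝ] E4).symm : E4 →L[ℝ] E4)) + (Kerr.bilin (M i) (a i) (poincareInv (Λ' i t) 0 (x - E4.ofTimeSpace t (ξ i t)))).bilinearComp ((iteratedDeriv 2 Ai t).comp ((((Λ' i t) : E4 ≃L[ℝ] E4).symm : E4 →L[ℝ] E4))) ((((Λ' i t) : E4 ≃L[ℝ] E4).symm : E4 →L[ℝ] E4))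 + (Kerr.bilin (M i) (a i) (poincareInv (Λ' i t) 0 (x - E4.ofTimeSpace t (ξ i t)))).bilinearComp ((((Λ' i t) : E4 ≃L[ℝ] E4).symm : E4 →L[ℝ] E4)) ((iteratedDeriv 2 Ai t).comp ((((Λ' i t) : E4 ≃L[ℝ] E4).symm : E4 →L[ℝ] E4))))‖ +
          ‖∑ j ∈ Finset.univ.erase i, iteratedDeriv 3 (fun s ↦ boostedKerrBilin (Λ j s) (E4.ofTimeSpace s (ξ j s)) (M j) (a j) x) t‖ :=
          norm_add_le _ _
      _ ≤ C * E₁ i + ∑ j ∈ Finset.univ.erase i, C * (ρ j)⁻¹ * (E₃ j + E₂ j + E₁ j) := by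
          refine add_le_add ((hO3' (hE₂ i)).trans ?_) (higherOrder_norm_sum_le_of_le _ fun j _ ↦ bP₃ hE₂ j)
          calc |M i| * C₂ * Q i ^ 4 * (14 * E₁ i) = (|M i| * C₂ * Q i ^ 4 * 14) * E₁ i := by ring
            _ ≤ C * E₁ i := mul_le_mul_of_nonneg_right hMC₂' (hE₁0 i)
  · have h : P₃ x = ∑ j, iteratedDeriv 3 (fun s ↦ boostedKerrBilin (Λ j s) (E4.ofTimeSpace s (ξ j s)) (M j) (a j) x) t := hP3
    rw [h]
    exact (higherOrder_norm_sum_le_of_le _ fun j _ ↦ bP₃ hE₂ j).trans (hsumC _ fun j ↦ by positivity)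

/-- **Registered one-line carrier form** (`higherOrder_sumCoeff_EF`) of `higherOrder_sum_coeff_le`.
[folklore] -/
theorem higherOrder_sumCoeff_EF : ∀ {N : ℕ} (s : Finset (Fin N)) {c e : Fin N → ℝ} {C : ℝ}, (∀ j ∈ s, c j ≤ C) → (∀ j ∈ s, 0 ≤ e j) → ∑ j ∈ s, c j * e j ≤ C * ∑ j ∈ s, e j :=
  fun s _ _ _ hc he ↦ higherOrder_sum_coeff_le s hc he

end Summit.FinalStateConjecture.FinalStateConjecture.Theorems.SublinearIsFree.Slaving

end
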